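import Summits.ResolutionOfSingularities.ResolutionOfSingularities.Theorems.WeightedInvariantHomogeneousMinimalPrimes
import HarnessLib

/-!
# SPEC (Δ5) — homogeneous ideals are determined by their localisations at HOMOGENEOUS primes (sketch, res-L1-w43-plan-1 g12)

Route `ResolutionOfSingularities/WeightedInvariant`, door crux `HypersurfaceCentreConstruction` (stmt-19897), line
`local-engine`, skeleton v3.11 stub `stub_e2_centre_h` (ORDER (o47)): the UNIQUENESS half of the e = 2 centre.  For a
`ℤʲ`-graded commutative ring `A` and homogeneous ideals `I, J`: if `J_P ≤ I_P` at every HOMOGENEOUS prime `P` then `J ≤ I`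
(no Noetherian hypothesis; proof by the homogeneous colon ideal and a minimal prime over it, which is homogeneous by the
tree's `isHomogeneous_of_mem_minimalPrimes`).  Consequence for (o47): two torus-homogeneous candidate centres with the same
stalks at the ORBIT-GENERIC points agree — the e = 2 canonical centre is glued from chart-local presentations by uniqueness.
Pure algebra; nothing about Hironaka's problem is claimed. AI-written, weaker than expert review.
-/

set_option linter.dupNamespace false

open DirectSum

namespace Summit.ResolutionOfSingularities.ResolutionOfSingularities.Theorems

variable {j : ℕ} {A : Type} [CommRing A] (𝒜 : (Fin j → ℤ) → AddSubgroup A) [GradedRing 𝒜]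

/-- The colon ideal `(I : y)` of a homogeneous ideal by a homogeneous element is homogeneous. [folklore] -/
theorem isHomogeneous_colon_singleton_of_mem {I : Ideal A} (hI : I.IsHomogeneous 𝒜) {y : A} {d : Fin j → ℤ}
    (hy : y ∈ 𝒜 d) : (I.colon ({y} : Set A)).IsHomogeneous 𝒜 := by
  intro i a ha
  rw [Submodule.mem_colon_singleton, smul_eq_mul] at ha ⊢
  have h := hI (i + d) ha
  rwa [coe_decompose_mul_add_of_right_mem 𝒜 hy] at h

/-- **Homogeneous local-to-global**: for homogeneous ideals `I, J` of a `ℤʲ`-graded commutative ring, if `J_P ≤ I_P` at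
every homogeneous prime `P`, then `J ≤ I`. [folklore] -/
theorem le_of_forall_isHomogeneous_prime_map_le {I J : Ideal A} (hI : I.IsHomogeneous 𝒜) (hJ : J.IsHomogeneous 𝒜)
    (h : ∀ (P : Ideal A) [P.IsPrime], P.IsHomogeneous 𝒜 →
      J.map (algebraMap A (Localization.AtPrime P)) ≤ I.map (algebraMap A (Localization.AtPrime P))) :
    J ≤ I := by
  classical
  intro x hx
  rw [← sum_support_decompose 𝒜 x]
  refine Ideal.sum_mem _ (fun i _ => ?_)
  have hyJ : (decompose 𝒜 x i : A) ∈ J := (hJ.mem_iff 𝒜).mp hx i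
  set y : A := (decompose 𝒜 x i : A) with hy_def
  have hy : y ∈ 𝒜 i := SetLike.coe_mem _
  by_contra hyI
  -- the homogeneous colon ideal `(I : y)` is proper
  set 𝔞 : Ideal A := I.colon ({y} : Set A) with h𝔞_def
  have h𝔞 : 𝔞.IsHomogeneous 𝒜 := isHomogeneous_colon_singleton_of_mem 𝒜 hI hy
  have h𝔞top : 𝔞 ≠ ⊤ := by
    intro htop
    have h1 : (1 : A) ∈ 𝔞 := htop ▸ Submodule.mem_top
    rw [Submodule.mem_colon_singleton, smul_eq_mul, one_mul] at h1
    exact hyI h1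
  -- a minimal prime over it is homogeneous
  obtain ⟨P, hP⟩ := Ideal.nonempty_minimalPrimes h𝔞top
  haveI : P.IsPrime := hP.1.1
  have hPhom : P.IsHomogeneous 𝒜 := isHomogeneous_of_mem_minimalPrimes 𝒜 h𝔞 hP
  have h𝔞P : 𝔞 ≤ P := hP.1.2
  -- `y/1 ∈ J_P ≤ I_P` gives `m * y ∈ I` for some `m ∉ P`, i.e. `m ∈ (I : y) ≤ P`: contradiction
  have hyP : algebraMap A (Localization.AtPrime P) y ∈ I.map (algebraMap A (Localization.AtPrime P)) :=
    h P hPhom (Ideal.mem_map_of_mem _ hyJ)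
  obtain ⟨m, hm, hmy⟩ :=
    (IsLocalization.algebraMap_mem_map_algebraMap_iff P.primeCompl (Localization.AtPrime P) I y).mp hyP
  have hm𝔞 : m ∈ 𝔞 := by
    rw [h𝔞_def, Submodule.mem_colon_singleton, smul_eq_mul]
    exact hmy
  exact hm (h𝔞P hm𝔞)

/-- Equality form. [folklore] -/
theorem eq_of_forall_isHomogeneous_prime_map_eq {I J : Ideal A} (hI : I.IsHomogeneous 𝒜) (hJ : J.IsHomogeneous 𝒜)
    (h : ∀ (P : Ideal A) [P.IsPrime], P.IsHomogeneous 𝒜 →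
      J.map (algebraMap A (Localization.AtPrime P)) = I.map (algebraMap A (Localization.AtPrime P))) :
    J = I :=
  le_antisymm (le_of_forall_isHomogeneous_prime_map_le 𝒜 hI hJ (fun P _ hP => (h P hP).le))
    (le_of_forall_isHomogeneous_prime_map_le 𝒜 hJ hI (fun P _ hP => (h P hP).ge))

end Summit.ResolutionOfSingularities.ResolutionOfSingularities.Theorems
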